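import Literature.NumberTheory.EllipticCurves.PAdicLFunction
import HarnessLib

/-!
# TRIAGE r1 seat 2 — GEN 18 companion: the 2-adic SCALING FLOOR for Kurihara witnesses at `2`

Crux `OrdMissingLowerBoundAtTwo` (stmt-BirchSwinnertonDyer-19577), card `lambda-kolyvagin-rigidity-two`
(line file `Cruxes/OrdMissingLowerBoundAtTwo/Lines/lambda_kolyvagin_rigidity_two.lean`, UNPICKED reserve line L2).
Its lever `SharpKuriharaWitnessAtTwo W f` asks for a scaling `c ≠ 0` with the INTEGRALITY CLAUSE
`∀ r : ℚ, ‖((c * ratPlusSymbol f r : ℚ) : ℚ_[2])‖ ≤ 1` and a level `1 ≤ k ≤ ord₂ Tam(W) + padicValRat 2 c + 1`.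
GEN 17 of this seat (TRIAGE-r1-2.md §N2) proposed to ADD the hypothesis `1 ≤ ord₂ Tam(W) + padicValRat 2 c`
(to exclude the degenerate corner `e + t = 0`, where the witness would be a level-1 UNIT witness, the shape
refuted on the evenness class by p653405). THIS FILE SHOWS THE HYPOTHESIS IS REDUNDANT:

* §1 (kernel, sorry-free): if the symbol values `S : ℚ → ℚ` contain a HALF-STEP (two arguments whose values
  differ by an odd half-integer) then every `c ≠ 0` with all `c · S r` `2`-integral has `1 ≤ padicValRat 2 c`.
* §2 (kernel modulo the tree's NAMED analytic facts, passed as hypotheses by name): for a weight-2 newform `f`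
  on `Γ₀(N)`, `N ≥ 2`, with rational (real) coefficients and `Ω⁺_f > 0`, the rational plus symbols DO contain a
  half-step: `re Λ_f = ℤ · Ω⁺_f/2` (definition of `plusPeriod`), `γ ↦ {∞, γ∞}_f` is a homomorphism onto `Λ_f`
  (`cuspSymbol_mul`), so some `γ ∈ Γ₀(N)` has `re {∞, γ∞}_f = Ω⁺_f/2`; by the Manin relation
  (`modularSymbol_gamma0_smul` at `r = 0`) `{∞, γ0}_f = {∞, γ∞}_f + {∞, 0}_f`, hence `[γ0]⁺ − [0]⁺ = 1/2`.
* §3: the consequence for the card, stated on its integrality clause verbatim: `1 ≤ padicValRat 2 c`, so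
  `1 ≤ ord₂ Tam(W) + padicValRat 2 c` holds AUTOMATICALLY and the corner `e + t = 0` is EMPTY.

Nothing here proves or refutes the crux, the card, or BSD; it is a triage sharpening (hypothesis redundancy).
-/

set_option linter.dupNamespace false

namespace Summit.BirchSwinnertonDyer.BirchSwinnertonDyer.Cruxes.OrdMissingLowerBoundAtTwo.TriageR12ScalingFloor

open Literature.NumberTheory.EllipticCurves Literature.NumberTheory.EllipticCurves.ModularForms
open scoped MatrixGroups ModularForm
open CongruenceSubgroup

/-! ## §1 Kernel core: a half-step forces an even scaling -/

/-- `HalfStep S`: two arguments whose `S`-values differ by an odd half-integer `m/2`. -/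
def HalfStep (S : ℚ → ℚ) : Prop :=
  ∃ r₁ r₂ : ℚ, ∃ m : ℤ, Odd m ∧ S r₂ - S r₁ = m / 2

/-- If `x ≠ 0` is `2`-integral in `ℚ_[2]` then `0 ≤ padicValRat 2 x`. -/
theorem padicValRat_nonneg_of_norm_le_one {x : ℚ} (hx : x ≠ 0)
    (h : ‖((x : ℚ) : ℚ_[2])‖ ≤ 1) : 0 ≤ padicValRat 2 x := by
  rw [Padic.eq_padicNorm] at h
  have h' : padicNorm 2 x ≤ 1 := by exact_mod_cast h
  rw [padicNorm.eq_zpow_of_nonzero hx] at h'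
  have h'' : -padicValRat 2 x ≤ 0 :=
    (zpow_le_one_iff_right₀ (by norm_num : (1 : ℚ) < ((2 : ℕ) : ℚ))).mp h'
  linarith

/-- **Scaling floor (core).** A half-step among the values of `S` forces every admissible scaling
`c` (all `c · S r` `2`-integral) to be EVEN: `1 ≤ padicValRat 2 c`. -/
theorem one_le_padicValRat_two_of_integral_of_halfStep (S : ℚ → ℚ) {c : ℚ} (hc : c ≠ 0)
    (hint : ∀ r : ℚ, ‖((c * S r : ℚ) : ℚ_[2])‖ ≤ 1) (h : HalfStep S) :
    1 ≤ padicValRat 2 c := by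
  obtain ⟨r₁, r₂, m, hm, hstep⟩ := h
  have hmz : m ≠ 0 := by
    rintro rfl
    exact (by decide : ¬ Odd (0 : ℤ)) hm
  have hm0 : (m : ℚ) ≠ 0 := by exact_mod_cast hmz
  -- the difference of two `2`-integral numbers is `2`-integral
  have hdiff : ‖(((c * S r₂ - c * S r₁ : ℚ)) : ℚ_[2])‖ ≤ 1 := by
    have h2 := hint r₂
    have h1 := hint r₁
    push_cast at h1 h2 ⊢
    rw [sub_eq_add_neg]
    refine (Padic.nonarchimedean _ _).trans ?_
    rw [norm_neg]
    exact max_le h2 h1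
  have hval : c * S r₂ - c * S r₁ = c * m / 2 := by
    rw [← mul_sub, hstep]; ring
  rw [hval] at hdiff
  have hcm : c * (m : ℚ) ≠ 0 := mul_ne_zero hc hm0
  have hne : c * m / 2 ≠ 0 := div_ne_zero hcm two_ne_zero
  have hnonneg := padicValRat_nonneg_of_norm_le_one hne hdiff
  -- `padicValRat 2 (c * m / 2) = padicValRat 2 c + 0 - 1`
  have hm' : padicValRat 2 (m : ℚ) = 0 := by
    rw [padicValRat.of_int]
    simp only [Nat.cast_eq_zero]
    refine padicValInt.eq_zero_of_not_dvd ?_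
    intro h2
    have h2' : (2 : ℤ) ∣ m := by exact_mod_cast h2
    exact (Int.not_even_iff_odd.mpr hm) (even_iff_two_dvd.mpr h2')
  have h22 : padicValRat 2 (2 : ℚ) = 1 := by
    exact_mod_cast padicValRat.self (p := 2) one_lt_two
  rw [padicValRat.div hcm two_ne_zero, padicValRat.mul hc hm0, hm', h22] at hnonneg
  linarith

/-! ## §2 Bridge: rational newforms HAVE a half-step (kernel modulo the tree's named analytic facts) -/

section Bridge

variable {N : ℕ}

/-- Every element of `Λ_f = closure (range cuspSymbol)` is a single cusp symbol, because
`γ ↦ {∞, γ∞}_f` is a homomorphism (`cuspSymbol_mul`, a tree named fact, taken as hypothesis). -/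
theorem exists_cuspSymbol_eq_of_mem_periodLattice [NeZero N] (f : CuspForm (Gamma0 N) 2)
    (Hmul : cuspSymbol_mul f) {z : ℂ} (hz : z ∈ periodLattice f) :
    ∃ γ : Gamma0 N, cuspSymbol f γ = z := by
  unfold periodLattice at hz
  induction hz using AddSubgroup.closure_induction with
  | mem x hx => exact hx
  | zero => exact ⟨1, cuspSymbol_one f⟩
  | add x y _ _ hx hy =>
    obtain ⟨γ, rfl⟩ := hx
    obtain ⟨δ, rfl⟩ := hy
    exact ⟨γ * δ, Hmul γ δ⟩
  | neg x _ hx =>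
    obtain ⟨γ, rfl⟩ := hx
    refine ⟨γ⁻¹, ?_⟩
    have h := Hmul γ⁻¹ γ
    rw [inv_mul_cancel, cuspSymbol_one] at h
    linear_combination -h

/-- For `γ ∈ Γ₀(N)` with `N ≥ 2` the lower-right entry is non-zero (else `N ∣ γ₁₀ = ±1`). -/
theorem entry_one_one_ne_zero (hN : 2 ≤ N) (γ : Gamma0 N) : ((γ : SL(2, ℤ)) 1 1 : ℤ) ≠ 0 := by
  intro h0
  have hmem := γ.2
  rw [Gamma0_mem] at hmem
  have hdvd : (N : ℤ) ∣ ((γ : SL(2, ℤ)) 1 0 : ℤ) := (ZMod.intCast_zmod_eq_zero_iff_dvd _ N).mp hmem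
  have hdet := Matrix.SpecialLinearGroup.det_coe (γ : SL(2, ℤ))
  rw [Matrix.det_fin_two] at hdet
  rw [h0, mul_zero, zero_sub] at hdet
  have h1 : (N : ℤ) ∣ 1 := by
    have : (N : ℤ) ∣ -(((γ : SL(2, ℤ)) 0 1 : ℤ) * ((γ : SL(2, ℤ)) 1 0 : ℤ)) :=
      (Dvd.dvd.mul_left hdvd _).neg_right
    rwa [hdet] at this
  have hN1 : N ∣ 1 := by exact_mod_cast h1
  have := Nat.le_of_dvd one_pos hN1
  omega

/-- **Half-step for rational newforms.** For a weight-2 newform `f` on `Γ₀(N)`, `N ≥ 2`, with rational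
(hence real) coefficients and `Ω⁺_f > 0`: `[γ0]⁺_f − [0]⁺_f = 1/2` for some `γ ∈ Γ₀(N)`. The analytic inputs
are the tree's NAMED FACTS, passed by name: `cuspSymbol_mul` (Manin 1972 Prop. 1.4), `modularSymbol_gamma0_smul`
(Manin relation), `plusSymbol_eq_re` (Cremona §2.8), `ratCast_ratPlusSymbol` (Manin–Drinfeld / MTT §I.8);
`re Λ_f = ℤ · Ω⁺_f/2` is the DEFINITION of `plusPeriod` once `Ω⁺_f > 0`. -/
theorem halfStep_ratPlusSymbol [NeZero N] (hN : 2 ≤ N) (f : CuspForm (Gamma0 N) 2)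
    (hf : IsNewform0 f) (hQ : coeffField f = ⊥) (hreal : ∀ n, (cuspCoeff f n).im = 0)
    (hΩ : 0 < plusPeriod f)
    (Hmul : cuspSymbol_mul f) (Hmanin : modularSymbol_gamma0_smul f) (Hre : plusSymbol_eq_re f)
    (Hrat : ratCast_ratPlusSymbol (N := N)) :
    HalfStep (ratPlusSymbol f) := by
  classical
  -- Step 1: `re Λ_f = ℤ · Ω⁺_f/2` (definition of `plusPeriod`, non-junk branch)
  have hex : ∃ Ω : ℝ, 0 < Ω ∧ realPeriods f = AddSubgroup.zmultiples (Ω / 2) := by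
    by_contra hno
    have : plusPeriod f = 0 := by unfold plusPeriod; rw [dif_neg hno]
    linarith
  have hgen : realPeriods f = AddSubgroup.zmultiples (plusPeriod f / 2) := by
    have h1 : plusPeriod f = hex.choose := by unfold plusPeriod; rw [dif_pos hex]
    rw [h1]; exact hex.choose_spec.2
  -- Step 2: some period `z = {∞, γ∞}_f` has real part exactly `Ω⁺_f/2`
  have hmem : plusPeriod f / 2 ∈ realPeriods f := by
    rw [hgen]; exact AddSubgroup.mem_zmultiples _
  rw [realPeriods, AddSubgroup.mem_map] at hmem
  obtain ⟨z, hz, hzre⟩ := hmem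
  have hzre' : z.re = plusPeriod f / 2 := by simpa using hzre
  obtain ⟨γ, hγ⟩ := exists_cuspSymbol_eq_of_mem_periodLattice f Hmul hz
  -- Step 3: Manin relation at `r = 0`: `{∞, γ0}_f = {∞, γ∞}_f + {∞, 0}_f`
  have hd : ((γ : SL(2, ℤ)) 1 1 : ℤ) ≠ 0 := entry_one_one_ne_zero hN γ
  have hdQ : (((γ : SL(2, ℤ)) 1 1 : ℤ) : ℚ) ≠ 0 := by exact_mod_cast hd
  have hM := Hmanin γ 0 (by rw [mul_zero, zero_add]; exact hdQ)
  rw [mul_zero, zero_add, mul_zero, zero_add] at hM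
  -- Step 4: normalise
  refine ⟨0, (((γ : SL(2, ℤ)) 0 1 : ℤ) : ℚ) / (((γ : SL(2, ℤ)) 1 1 : ℤ) : ℚ), 1, odd_one, ?_⟩
  have hΩ0 : plusPeriod f ≠ 0 := hΩ.ne'
  have hn : normalizedPlusSymbol f ((((γ : SL(2, ℤ)) 0 1 : ℤ) : ℚ) / (((γ : SL(2, ℤ)) 1 1 : ℤ) : ℚ))
      - normalizedPlusSymbol f 0 = 1 / 2 := by
    unfold normalizedPlusSymbol
    rw [Hre hreal, Hre hreal 0, hM]
    simp only [Complex.ofReal_re, Complex.add_re]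
    rw [hγ, hzre']
    field_simp
    ring
  have h2 : ((ratPlusSymbol f ((((γ : SL(2, ℤ)) 0 1 : ℤ) : ℚ) / (((γ : SL(2, ℤ)) 1 1 : ℤ) : ℚ))
      - ratPlusSymbol f 0 : ℚ) : ℝ) = (((1 : ℤ) : ℚ) / 2 : ℚ) := by
    push_cast
    rw [Hrat hf hQ, Hrat hf hQ, hn]
  exact_mod_cast h2

end Bridge

/-! ## §3 Consequence for the card's lever (integrality clause verbatim, `t = ord₂ Tam(W)`) -/

/-- GEN 17's proposed extra hypothesis `1 ≤ ord₂ Tam(W) + padicValRat 2 c` of `SharpWitnessSupplyBigImageAtTwo`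
is AUTOMATIC: the integrality clause of `SharpKuriharaWitnessAtTwo` plus a half-step give `1 ≤ padicValRat 2 c`
already, for every `t : ℕ` (in the card `t = padicValNat 2 W.tamagawaProduct`). -/
theorem one_le_tam_add_padicValRat_of_integral {N : ℕ} (f : CuspForm (Gamma0 N) 2) (t : ℕ) {c : ℚ}
    (hc : c ≠ 0) (hint : ∀ r : ℚ, ‖((c * ratPlusSymbol f r : ℚ) : ℚ_[2])‖ ≤ 1)
    (h : HalfStep (ratPlusSymbol f)) :
    1 ≤ (t : ℤ) + padicValRat 2 c := by
  have h1 := one_le_padicValRat_two_of_integral_of_halfStep _ hc hint h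
  have ht : (0 : ℤ) ≤ t := Int.natCast_nonneg t
  linarith


end Summit.BirchSwinnertonDyer.BirchSwinnertonDyer.Cruxes.OrdMissingLowerBoundAtTwo.TriageR12ScalingFloor
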